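import Mathlib

/-!
# The (2,2,2)-star statement TvT is a consequence of Harris-cone membership of the core's table
(blind cell PercRepro2, night-3 g28, 2026-08-29; `proofs/NIGHT3-CERT.md` §37.6)

A cubic form `N` on laws `μ : Fin 5 → ℚ` (masses on the five partitions `⊥, 01, 02, 12, ⊤` of the three
ends of a star) has the symmetric trilinear polarisation `B N x y z`; at unit laws `e i` the values
`B N (e i) (e j) (e k)` are the symmetrised table entries divided by the number of orderings.  The typed
bases of core + star are finite sums of such values (NIGHT3-CERT §36.2 / §37.6): for the `(2,2,2)`-star
the base is `3 B(e0,e4,e4) + tvt N` and the cell's **TvT** (`StarPayment.TvT`, `0 ≤ A + Σ_p E_p`) is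
`tvt N = 6 (B(e0,e1,e4) + B(e0,e2,e4) + B(e0,e3,e4) + B(e1,e2,e3))`.

THEOREM: if `N` lies in the Harris cone — a nonnegative combination of the 35 cubic monomials
`mono i j k` and the 45 products `hgen i s` of a coordinate with one of the nine homogenised Harris
slacks of the partition lattice — then `0 ≤ tvt N`, `0 ≤ B N e0 e4 e4` (the cell's `B(T₂) ≥ 0`, TriCH)
and `0 ≤ B N e0 (e p) e4` (`E_p ≥ 0`, NPM): every generator has nonnegative value on these functionals
(`tvt_mono_nonneg`, `tvt_hgen_nonneg`, … — 125 + 45 evaluations each), and the functionals are linear.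
The certificate itself is an exact finite computation per (core, type vector) (`certlp.py`; found on all
346,168 typed tables and 32,088 weighted cores of §37); what this file adds is the kernel-checked step
«certificate ⟹ TvT / B(T₂) / E_p», independent of the core.  Own work; standard axioms.
-/

namespace Summit.Ventures.PercRepro2

namespace ThreeTerm

/-- The unit law concentrated on the partition `i`. -/
def e (i : Fin 5) : Fin 5 → ℚ := fun j => if j.val = i.val then 1 else 0

/-- Unit laws are nonnegative coordinatewise. -/
lemma e_nonneg (i j : Fin 5) : 0 ≤ e i j := by
  unfold e; split_ifs <;> norm_num

/-- The symmetric trilinear polarisation of a cubic `N` (for a homogeneous cubic, `N μ = B N μ μ μ`). -/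
def B (N : (Fin 5 → ℚ) → ℚ) (x y z : Fin 5 → ℚ) : ℚ :=
  (N (x + y + z) - N (x + y) - N (x + z) - N (y + z) + N x + N y + N z) / 6

/-- **TvT** of a cubic: `6 (B(e0,e1,e4) + B(e0,e2,e4) + B(e0,e3,e4) + B(e1,e2,e3))` — the cell's
`Σ_p E_p + A` read off the table (`E_p` = the orbit `(⊥, p, ⊤)`, `A` = the orbit `(01, 02, 12)`). -/
def tvt (N : (Fin 5 → ℚ) → ℚ) : ℚ :=
  6 * (B N (e 0) (e 1) (e 4) + B N (e 0) (e 2) (e 4) + B N (e 0) (e 3) (e 4) + B N (e 1) (e 2) (e 3))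

/-- The cubic monomial `μ i μ j μ k`. -/
def mono (i j k : Fin 5) : (Fin 5 → ℚ) → ℚ := fun μ => μ i * μ j * μ k

/-- The nine homogenised Harris slacks of the partition lattice of three ends, as explicit quadratics
(`μ 0 = ⊥`, `μ 1 = 01`, `μ 2 = 02`, `μ 3 = 12`, `μ 4 = ⊤`; `μ(U_S ∩ U_S′)(Σμ) − μ(U_S) μ(U_S′)`):
`(U_1,U_2)`, `(U_1,U_3)`, `(U_2,U_3)`, `(U_1,U_23)`, `(U_2,U_13)`, `(U_3,U_12)`, `(U_12,U_13)`, `(U_12,U_23)`, `(U_13,U_23)`. -/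
def hslack (s : Fin 9) (μ : Fin 5 → ℚ) : ℚ :=
  match s with
  | 0 => μ 0 * μ 4 + μ 3 * μ 4 - μ 1 * μ 2
  | 1 => μ 0 * μ 4 + μ 2 * μ 4 - μ 1 * μ 3
  | 2 => μ 0 * μ 4 + μ 1 * μ 4 - μ 2 * μ 3
  | 3 => μ 0 * μ 4 - μ 1 * μ 2 - μ 1 * μ 3
  | 4 => μ 0 * μ 4 - μ 1 * μ 2 - μ 2 * μ 3
  | 5 => μ 0 * μ 4 - μ 1 * μ 3 - μ 2 * μ 3
  | 6 => μ 0 * μ 1 + μ 0 * μ 4 - μ 2 * μ 3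
  | 7 => μ 0 * μ 2 + μ 0 * μ 4 - μ 1 * μ 3
  | 8 => μ 0 * μ 3 + μ 0 * μ 4 - μ 1 * μ 2

/-- The Harris generator `μ i · hslack s`. -/
def hgen (i : Fin 5) (s : Fin 9) : (Fin 5 → ℚ) → ℚ := fun μ => μ i * hslack s μ

/-- `B` is linear in `N`: a finite sum. -/
lemma B_sum {ι : Type*} (t : Finset ι) (f : ι → (Fin 5 → ℚ) → ℚ) (x y z : Fin 5 → ℚ) :
    B (fun μ => ∑ g ∈ t, f g μ) x y z = ∑ g ∈ t, B (f g) x y z := by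
  unfold B
  rw [← Finset.sum_div]
  congr 1
  simp only [Finset.sum_add_distrib, Finset.sum_sub_distrib]

/-- `B` is homogeneous in `N`: a scalar multiple. -/
lemma B_smul (c : ℚ) (f : (Fin 5 → ℚ) → ℚ) (x y z : Fin 5 → ℚ) :
    B (fun μ => c * f μ) x y z = c * B f x y z := by
  simp only [B]; ring

/-- `B` of a sum of two cubics. -/
lemma B_add (f g : (Fin 5 → ℚ) → ℚ) (x y z : Fin 5 → ℚ) :
    B (fun μ => f μ + g μ) x y z = B f x y z + B g x y z := by
  simp only [B]; ring

/-- `tvt` of a finite sum. -/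
lemma tvt_sum {ι : Type*} (t : Finset ι) (f : ι → (Fin 5 → ℚ) → ℚ) :
    tvt (fun μ => ∑ g ∈ t, f g μ) = ∑ g ∈ t, tvt (f g) := by
  simp only [tvt, B_sum]
  rw [← Finset.mul_sum]
  congr 1
  simp only [Finset.sum_add_distrib]

/-- `tvt` of a scalar multiple. -/
lemma tvt_smul (c : ℚ) (f : (Fin 5 → ℚ) → ℚ) : tvt (fun μ => c * f μ) = c * tvt f := by
  simp only [tvt, B_smul]; ring

/-- `tvt` of a sum of two cubics. -/
lemma tvt_add (f g : (Fin 5 → ℚ) → ℚ) : tvt (fun μ => f μ + g μ) = tvt f + tvt g := by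
  simp only [tvt, B_add]; ring

/-- The polarisation of a monomial at three laws: the symmetrised product. -/
lemma B_mono (i j k : Fin 5) (x y z : Fin 5 → ℚ) :
    B (mono i j k) x y z = (x i * y j * z k + x i * z j * y k + y i * x j * z k + y i * z j * x k +
      z i * x j * y k + z i * y j * x k) / 6 := by
  simp only [B, mono, Pi.add_apply]; ring

/-- At unit laws the polarisation of a monomial is nonnegative. -/
lemma B_mono_nonneg (i j k a b c : Fin 5) : 0 ≤ B (mono i j k) (e a) (e b) (e c) := by
  rw [B_mono]
  have h1 := e_nonneg a i; have h2 := e_nonneg a j; have h3 := e_nonneg a k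
  have h4 := e_nonneg b i; have h5 := e_nonneg b j; have h6 := e_nonneg b k
  have h7 := e_nonneg c i; have h8 := e_nonneg c j; have h9 := e_nonneg c k
  positivity

/-- Every cubic monomial has nonnegative `tvt`. -/
lemma tvt_mono_nonneg (i j k : Fin 5) : 0 ≤ tvt (mono i j k) := by
  unfold tvt
  have h1 := B_mono_nonneg i j k 0 1 4; have h2 := B_mono_nonneg i j k 0 2 4
  have h3 := B_mono_nonneg i j k 0 3 4; have h4 := B_mono_nonneg i j k 1 2 3
  positivity

/-- Every Harris generator has nonnegative `tvt` (45 evaluations). -/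
lemma tvt_hgen_nonneg (i : Fin 5) (s : Fin 9) : 0 ≤ tvt (hgen i s) := by
  fin_cases i <;> fin_cases s <;> simp only [tvt, B, hgen, hslack, e, Pi.add_apply, Fin.isValue] <;> norm_num

/-- **Harris-cone membership of a cubic** `N`: nonnegative multipliers on the cubic monomials (indexed by all
ordered triples, repetitions harmless) and on the 45 Harris generators, with `N` equal to the combination. -/
def InCone (N : (Fin 5 → ℚ) → ℚ) : Prop :=
  ∃ (lm : Fin 5 → Fin 5 → Fin 5 → ℚ) (lh : Fin 5 → Fin 9 → ℚ),
    (∀ i j k, 0 ≤ lm i j k) ∧ (∀ i s, 0 ≤ lh i s) ∧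
    ∀ μ, N μ = (∑ i, ∑ j, ∑ k, lm i j k * mono i j k μ) + ∑ i, ∑ s, lh i s * hgen i s μ

/-- **TvT from the cone**: `0 ≤ tvt N` whenever `N` is in the Harris cone. -/
theorem tvt_nonneg_of_inCone (N : (Fin 5 → ℚ) → ℚ) (h : InCone N) : 0 ≤ tvt N := by
  obtain ⟨lm, lh, hm, hh, heq⟩ := h
  have hN : N = fun μ => (∑ i, ∑ j, ∑ k, lm i j k * mono i j k μ) + ∑ i, ∑ s, lh i s * hgen i s μ :=
    funext heq
  rw [hN, tvt_add]
  apply add_nonneg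
  · rw [tvt_sum]
    refine Finset.sum_nonneg fun i _ => ?_
    rw [tvt_sum]
    refine Finset.sum_nonneg fun j _ => ?_
    rw [tvt_sum]
    refine Finset.sum_nonneg fun k _ => ?_
    rw [tvt_smul]
    exact mul_nonneg (hm i j k) (tvt_mono_nonneg i j k)
  · rw [tvt_sum]
    refine Finset.sum_nonneg fun i _ => ?_
    rw [tvt_sum]
    refine Finset.sum_nonneg fun s _ => ?_
    rw [tvt_smul]
    exact mul_nonneg (hh i s) (tvt_hgen_nonneg i s)

/-- **A unit-polarisation value from the cone**: if every Harris generator has nonnegative polarisation at the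
unit laws `(e a, e b, e c)`, so has every cubic in the Harris cone (monomials always do). -/
theorem B_unit_nonneg_of_inCone (N : (Fin 5 → ℚ) → ℚ) (h : InCone N) (a b c : Fin 5)
    (hg : ∀ i s, 0 ≤ B (hgen i s) (e a) (e b) (e c)) : 0 ≤ B N (e a) (e b) (e c) := by
  obtain ⟨lm, lh, hm, hh, heq⟩ := h
  have hN : N = fun μ => (∑ i, ∑ j, ∑ k, lm i j k * mono i j k μ) + ∑ i, ∑ s, lh i s * hgen i s μ :=
    funext heq
  rw [hN, B_add]
  apply add_nonneg
  · rw [B_sum]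
    refine Finset.sum_nonneg fun i _ => ?_
    rw [B_sum]
    refine Finset.sum_nonneg fun j _ => ?_
    rw [B_sum]
    refine Finset.sum_nonneg fun k _ => ?_
    rw [B_smul]
    exact mul_nonneg (hm i j k) (B_mono_nonneg i j k a b c)
  · rw [B_sum]
    refine Finset.sum_nonneg fun i _ => ?_
    rw [B_sum]
    refine Finset.sum_nonneg fun s _ => ?_
    rw [B_smul]
    exact mul_nonneg (hh i s) (hg i s)

/-- The Harris generators at the orbit `(⊥, ⊤, ⊤)` (the cell's `B(T₂)`, TriCH): 45 evaluations. -/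
lemma hgen_B044_nonneg (i : Fin 5) (s : Fin 9) : 0 ≤ B (hgen i s) (e 0) (e 4) (e 4) := by
  fin_cases i <;> fin_cases s <;> simp only [B, hgen, hslack, e, Pi.add_apply, Fin.isValue] <;> norm_num

/-- The Harris generators at the orbit `(⊥, ⊥, ⊤)`: 45 evaluations. -/
lemma hgen_B004_nonneg (i : Fin 5) (s : Fin 9) : 0 ≤ B (hgen i s) (e 0) (e 0) (e 4) := by
  fin_cases i <;> fin_cases s <;> simp only [B, hgen, hslack, e, Pi.add_apply, Fin.isValue] <;> norm_num

/-- The Harris generators at the orbit `(⊥, 01, ⊤)`: 45 evaluations. -/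
lemma hgen_B014_nonneg (i : Fin 5) (s : Fin 9) : 0 ≤ B (hgen i s) (e 0) (e 1) (e 4) := by
  fin_cases i <;> fin_cases s <;> simp only [B, hgen, hslack, e, Pi.add_apply, Fin.isValue] <;> norm_num

/-- The Harris generators at the orbit `(⊥, 02, ⊤)`: 45 evaluations. -/
lemma hgen_B024_nonneg (i : Fin 5) (s : Fin 9) : 0 ≤ B (hgen i s) (e 0) (e 2) (e 4) := by
  fin_cases i <;> fin_cases s <;> simp only [B, hgen, hslack, e, Pi.add_apply, Fin.isValue] <;> norm_num

/-- The Harris generators at the orbit `(⊥, 12, ⊤)`: 45 evaluations. -/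
lemma hgen_B034_nonneg (i : Fin 5) (s : Fin 9) : 0 ≤ B (hgen i s) (e 0) (e 3) (e 4) := by
  fin_cases i <;> fin_cases s <;> simp only [B, hgen, hslack, e, Pi.add_apply, Fin.isValue] <;> norm_num

/-- The Harris generators at the orbits `(⊥, p, ⊤)` (the cell's `E_p`, NPM; every `p`). -/
lemma hgen_B0p4_nonneg (i : Fin 5) (s : Fin 9) (p : Fin 5) : 0 ≤ B (hgen i s) (e 0) (e p) (e 4) := by
  fin_cases p
  · exact hgen_B004_nonneg i s
  · exact hgen_B014_nonneg i s
  · exact hgen_B024_nonneg i s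
  · exact hgen_B034_nonneg i s
  · exact hgen_B044_nonneg i s

/-- `B(T₂)` of a cubic: the table entry of the orbit `(⊥, ⊤, ⊤)` — `3 B(e0,e4,e4)`. -/
def bT2 (N : (Fin 5 → ℚ) → ℚ) : ℚ := 3 * B N (e 0) (e 4) (e 4)

/-- `E_p` of a cubic: the table entry of the orbit `(⊥, p, ⊤)` — `6 B(e0,ep,e4)`. -/
def ep (p : Fin 5) (N : (Fin 5 → ℚ) → ℚ) : ℚ := 6 * B N (e 0) (e p) (e 4)

/-- The `(2,2,2)`-star typed base read off the table: `B(T₂) + TvT` (`3 + 18 + 6` placements). -/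
def star222 (N : (Fin 5 → ℚ) → ℚ) : ℚ := bT2 N + tvt N

/-- **TriCH's `B(T₂) ≥ 0` from the cone.** -/
theorem bT2_nonneg_of_inCone (N : (Fin 5 → ℚ) → ℚ) (h : InCone N) : 0 ≤ bT2 N := by
  unfold bT2
  have := B_unit_nonneg_of_inCone N h 0 4 4 (hgen_B044_nonneg)
  positivity

/-- **NPM's `E_p ≥ 0` from the cone** (every `p`). -/
theorem ep_nonneg_of_inCone (N : (Fin 5 → ℚ) → ℚ) (h : InCone N) (p : Fin 5) : 0 ≤ ep p N := by
  unfold ep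
  have := B_unit_nonneg_of_inCone N h 0 p 4 (fun i s => hgen_B0p4_nonneg i s p)
  positivity

/-- **The `(2,2,2)`-cell from the cone**: `0 ≤ B(T₂) + TvT`. -/
theorem star222_nonneg_of_inCone (N : (Fin 5 → ℚ) → ℚ) (h : InCone N) : 0 ≤ star222 N :=
  add_nonneg (bT2_nonneg_of_inCone N h) (tvt_nonneg_of_inCone N h)

end ThreeTerm

end Summit.Ventures.PercRepro2
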